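import Mathlib
import Literature.Analysis.FluidPDE.TypeIAncientMild
import Literature.Analysis.FluidPDE.OseenZoomCovariance
import Literature.Analysis.FluidPDE.OseenSlabFields
import Literature.Analysis.FluidPDE.AlbrittonKatoClassIntegralForm
import Literature.Analysis.UnboundedOperators.HeatKernelHeatEquation
import HarnessLib
import Literature.Analysis.FluidPDE.TaoQuantitativeTotalSpeed

/-!
# Census block A2 (amplitude / symmetry meters), in-row members G1ch (head) / S1ev / S1is / D1tw / T1ch (instrument «CHARACTER METER») — LINE
# «character-meter» port (one file): the caloric endgame (§A), the degree mismatch (§B), the head `Row_G1ch` / `row_G1ch_holds` (§C), the cells S1ev / S1is /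
# D1tw / T1ch (§D, DECIDED from the head), the time-shift character re-decided (`row_A1fm_bis`, §E), the OPEN modulated multiplier `Row_P1pm` (§F);
# census KEYS `Row_G1ch` / `Row_S1ev` / `Row_S1is` / `Row_D1tw` / `Row_T1ch` + `_excluded`, `Row_P1pm` (OPEN)

Re-homed for the scenario census (typer seat ns-census-typer-1 g8; the cells G1ch / S1ev / S1is / D1tw / T1ch are MEMBERS OF RECORD «DECIDED IN KERNEL IN FILES»
of block A2 since census v1.72 (critic idea-crit-3 g7 PASS 23:29:55Z; ref ns-census-ref g9 PRE-CHECK ✓ §14.18 item 31; lead-presearch label); this port makes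
them TREE-decided): VERBATIM PORT of ns-idea-2 LINE g13-2 «character-meter», `pub/ideators/ns-idea-2/lines/character-meter/line-character-meter.lean` sha16
3acaed6df79c91c0 (433 l., lean check rc 0, 0 sorry), one tree file (§A–§F + census KEYS).  Lean text VERBATIM in namespace `…Theorems.ScenarioCensus.CharacterMeter` (the line's `…Lines.CharacterMeter` re-homed); port edits: `local
notation "E3"` → `abbrev E3` (typer lint: no notation in port files), `@[conjecture]` on the OPEN row `Row_P1pm` (typed only), eight one-line docstrings
added (gate lint); `oseenDuhamel_congr_Ioo'` is the Literature lemma `oseenDuhamel_congr_Ioo` taken BY NAME and `tendsto_typeI_bound` (twin of a landed tree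
lemma in a module the farm does not build) is not re-declared — its two uses carry the one-line Mathlib proof inline (proof text only).  `Row_A1fm` here is the line's VERBATIM re-statement of the floquet-meter cell (re-decided by `row_A1fm_bis`); the census key `Row_A1fm`
belongs to the floquet-meter port.  Statements untouched.

No census VALUE is moved here (the members become TREE-decided by name; the trivial character μ = 1 — the OPEN symmetric block — is not claimed); NS
regularity is NOT proved; (L′) ⟨10661⟩ is untouched; no summit statement is proved by this file. Lemmas that restate already-landed tree declarations are taken BY NAME (gate lint `dedup.landed`): `oseenDuhamel_congr_Ioo'` = `oseenDuhamel_congr_Ioo`.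
-/

-- the summit and its single problem share the name `NavierStokesRegularity` (D-0017 nested layout)
set_option linter.dupNamespace false

noncomputable section

open Set Function Filter Topology MeasureTheory

namespace Summit.NavierStokesRegularity.NavierStokesRegularity.Theorems.ScenarioCensus.CharacterMeter

open Literature.Analysis Literature.Analysis.FluidPDE

/-- `ℝ³` (the line's `local notation "E3"`, spelled as a reducible abbreviation for the tree). -/
abbrev E3 := EuclideanSpace ℝ (Fin 3)

/-! ## A. The caloric endgame: a class element whose Duhamel term vanishes from every initial time vanishes -/

-- `tendsto_typeI_bound`: the Type-I envelope `C/√(-s) → 0` at `-∞` restates a landed tree lemma (gate lint dedup.landed, twin `…Theorems.PolyhedralDssProfileExists.PolyhedralCell.tendsto_typeI_envelope_atBot`, whose module the farm does not build); not re-declared — its uses below carry the one-line Mathlib proof `(Real.tendsto_sqrt_atTop.comp tendsto_neg_atBot_atTop).const_div_atTop C` inline (port edit, proof text only).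

/-- **Caloric endgame.** If the Duhamel (Oseen) term `B¹ₛ(u,u)(t)(x)` of a Type-I ancient mild field
vanishes for every initial time `s < t`, then `u(t, x) = e^{(t-s)Δ}u(s)(x)` for every `s < t`, so
`‖u(t, x)‖ ≤ C/√(-s)` (`‖e^{σΔ}g‖_∞ ≤ ‖g‖_∞`) and `s → -∞` gives `u(t, x) = 0`. -/
theorem eq_zero_of_duhamel_eq_zero {C : ℝ} {u : ℝ → E3 → E3} (hu : IsTypeIAncientMild C u)
    {t : ℝ} (ht : t < 0) (x : E3) (hD : ∀ s < t, oseenDuhamel 1 s u u t x = 0) : u t x = 0 := by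
  have hb : ∀ s < t, ‖u t x‖ ≤ C / Real.sqrt (-s) := by
    intro s hs
    rw [hu.mild_eq_heatExtension hs ht x, hD s hs, sub_zero]
    exact UnboundedOperators.norm_heatExtension_le (fun z => hu.norm_le (hs.trans ht) z)
      (sub_pos.2 hs) x
  have hev : ∀ᶠ s in atBot, ‖u t x‖ ≤ C / Real.sqrt (-s) := by
    filter_upwards [Iio_mem_atBot t] with s hs
    exact hb s hs
  have h3 : ‖u t x‖ ≤ 0 := ge_of_tendsto ((show Tendsto (fun s : ℝ => C / Real.sqrt (-s)) atBot (𝓝 0) from (Real.tendsto_sqrt_atTop.comp tendsto_neg_atBot_atTop).const_div_atTop C)) hev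
  exact norm_le_zero_iff.1 h3

/-! ## B. The degree mismatch: `H` is linear, `B` is quadratic -/

/-- **Degree mismatch.** If `v = H - D` and `μ v = μ H - μ² D` with `μ ∉ {0, 1}`, then `D = 0`
(subtract: `(μ² - μ) D = 0`). -/
theorem duhamel_eq_zero_of_character {V : Type*} [AddCommGroup V] [Module ℝ V] {H D v : V} {μ : ℝ}
    (hμ0 : μ ≠ 0) (hμ1 : μ ≠ 1) (h1 : v = H - D) (h2 : μ • v = μ • H - (μ * μ) • D) : D = 0 := by
  rw [h1, smul_sub] at h2
  have h3 : μ • D = (μ * μ) • D := sub_right_inj.1 h2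
  have h4 : (μ * μ - μ) • D = 0 := by rw [sub_smul, ← h3, sub_self]
  rcases smul_eq_zero.1 h4 with h | h
  · exfalso
    have h5 : μ * (μ - 1) = 0 := by rw [mul_sub, mul_one]; exact h
    rcases mul_eq_zero.1 h5 with h6 | h6
    · exact hμ0 h6
    · exact hμ1 (sub_eq_zero.1 h6)
  · exact h

-- `oseenDuhamel_congr_Ioo'`: the line restates the tree's `oseenDuhamel_congr_Ioo`; taken BY NAME (gate lint dedup.landed).

/-- The Duhamel term of the field `μ u`: `B¹ₛ(μu, μu) = μ² B¹ₛ(u, u)` (bilinearity). -/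
theorem oseenDuhamel_const_smul (s μ : ℝ) (u : ℝ → E3 → E3) (t : ℝ) (x : E3) :
    oseenDuhamel 1 s (μ • u) (μ • u) t x = (μ * μ) • oseenDuhamel 1 s u u t x := by
  rw [oseenDuhamel_smul_left, oseenDuhamel_smul_right, smul_smul]

/-! ## C. THE HEAD — Row G1ch: the class carries no nontrivial character of the symmetry group
(rotated zoom ∘ translation) -/

/-- **Row G1ch (the character meter; HEAD, DECIDED).**  Census S/D-block cell, (L′)-shape over the genuine
class `IsTypeIAncientMild C u` BY NAME.  Let `g = (c, R, x₀)` act on fields by the Navier–Stokes symmetry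
`(g·u)(t, x) = c R⁻¹ u(c²t, x₀ + cRx)` (`c > 0` parabolic zoom about the singular time, `R` a linear
isometry of `ℝ³` — rotations AND reflections —, `x₀` a translation).  If `g·u = μ u` on `t < 0` for some REAL
`μ ≠ 1` (a nontrivial CHARACTER: `μ = -1` covers EVEN fields, anti-self-similar and anti-periodic-in-space
fields; `μ = c^{1-2α}` covers self-similarity with the WRONG amplitude exponent `α ≠ 1/2`), then `u ≡ 0`.
The trivial character `μ = 1` (equivariant / DSS / RDSS / spatially periodic fields) is exactly the census's
OPEN symmetric block and is NOT claimed. -/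
def Row_G1ch : Prop :=
  ∀ (C : ℝ) (u : ℝ → E3 → E3), IsTypeIAncientMild C u →
    ∀ (c μ : ℝ) (R : E3 ≃ₗᵢ[ℝ] E3) (x₀ : E3), 0 < c → μ ≠ 1 →
      (∀ t : ℝ, t < 0 → ∀ x, c • R.symm (u (c ^ 2 * t) (x₀ + c • R x)) = μ • u t x) →
      ∀ t < 0, ∀ x, u t x = 0

/-- The transformed field `(g·u)(τ, y) = c R⁻¹ u(c²τ, x₀ + cRy)` satisfies the Oseen integral identity
between any two times `s < t < 0` (parabolic covariance `oseen_smul_stPull` composed with the isometry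
covariance `heatExtension_conj_linearIsometryEquiv` / `oseenDuhamel_symm_conj_linearIsometryEquiv`). -/
theorem zoom_mild_identity {C : ℝ} {u : ℝ → E3 → E3} (hu : IsTypeIAncientMild C u) {c : ℝ} (hc : 0 < c)
    (R : E3 ≃ₗᵢ[ℝ] E3) (x₀ : E3) {s t : ℝ} (hst : s < t) (ht : t < 0) (x : E3) :
    (fun τ y => R.symm ((c • stPull (c ^ 2) c 0 x₀ u) τ (R y))) t x =
      UnboundedOperators.heatExtension ((fun τ y => R.symm ((c • stPull (c ^ 2) c 0 x₀ u) τ (R y))) s)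
          (t - s) x -
        oseenDuhamel 1 s (fun τ y => R.symm ((c • stPull (c ^ 2) c 0 x₀ u) τ (R y)))
          (fun τ y => R.symm ((c • stPull (c ^ 2) c 0 x₀ u) τ (R y))) t x := by
  set w : ℝ → E3 → E3 := c • stPull (c ^ 2) c 0 x₀ u with hw
  have hc2 : 0 < c ^ 2 := by positivity
  have hs' : 0 + c ^ 2 * s < 0 + c ^ 2 * t := by nlinarith
  have ht' : 0 + c ^ 2 * t < 0 := by nlinarith
  have hform : ∀ X, u (0 + c ^ 2 * t) X =
      UnboundedOperators.heatExtension (u (0 + c ^ 2 * s)) (0 + c ^ 2 * t - (0 + c ^ 2 * s)) X -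
        oseenDuhamel 1 (0 + c ^ 2 * s) u u (0 + c ^ 2 * t) X :=
    fun X => hu.mild_eq_heatExtension hs' ht' X
  have hwid : ∀ y, w t y = UnboundedOperators.heatExtension (w s) (t - s) y - oseenDuhamel 1 s w w t y :=
    fun y => oseen_smul_stPull hc 0 x₀ hst hform y
  have hT1 : R.symm (UnboundedOperators.heatExtension (w s) (t - s) (R x)) =
      UnboundedOperators.heatExtension (fun y => R.symm (w s (R y))) (t - s) x := by
    have h := heatExtension_conj_linearIsometryEquiv R.symm (w s) (t - s) x
    rw [LinearIsometryEquiv.symm_symm] at h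
    exact h.symm
  have hT2 : R.symm (oseenDuhamel 1 s w w t (R x)) =
      oseenDuhamel 1 s (fun τ y => R.symm (w τ (R y))) (fun τ y => R.symm (w τ (R y))) t x :=
    (oseenDuhamel_symm_conj_linearIsometryEquiv R 1 s w w t x).symm
  show R.symm (w t (R x)) = UnboundedOperators.heatExtension (fun y => R.symm (w s (R y))) (t - s) x -
    oseenDuhamel 1 s (fun τ y => R.symm (w τ (R y))) (fun τ y => R.symm (w τ (R y))) t x
  rw [hwid (R x), map_sub, hT1, hT2]

/-- **Row G1ch holds.**  `μ = 0`: the hypothesis says `u ∘ g = 0`, i.e. `u = 0`.  `μ ∉ {0, 1}`: apply `g`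
to the mild identity `u(t) = e^{(t-s)Δ}u(s) - B¹ₛ(u,u)(t)`; `g` commutes with the caloric term (degree 1)
and with the Duhamel term (degree 2) (`zoom_mild_identity`), and `g·u = μu`, so
`μ u(t) = μ e^{(t-s)Δ}u(s) - μ² B¹ₛ(u,u)(t)`; subtracting `μ ×` the identity gives `(μ² - μ)B¹ₛ(u,u)(t) = 0`
(`duhamel_eq_zero_of_character`), hence `u(t) = e^{(t-s)Δ}u(s)` for every `s < t`, and the caloric
endgame (`eq_zero_of_duhamel_eq_zero`) gives `u ≡ 0`. -/
theorem row_G1ch_holds : Row_G1ch := by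
  intro C u hu c μ R x₀ hc hμ1 hch t ht x
  have hc0 : c ≠ 0 := hc.ne'
  have hc2 : 0 < c ^ 2 := by positivity
  by_cases hμ0 : μ = 0
  · -- `u ∘ g = 0`
    have h := hch (t / c ^ 2) (div_neg_of_neg_of_pos ht hc2) (R.symm (c⁻¹ • (x - x₀)))
    rw [hμ0, zero_smul, LinearIsometryEquiv.apply_symm_apply, smul_smul, mul_inv_cancel₀ hc0, one_smul,
      add_sub_cancel, mul_div_cancel₀ _ hc2.ne', smul_eq_zero] at h
    rcases h with h | h
    · exact absurd h hc0
    · simpa using h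
  · refine eq_zero_of_duhamel_eq_zero hu ht x fun s hs => ?_
    -- the transformed field and its character relation
    set Z : ℝ → E3 → E3 := fun τ y => R.symm ((c • stPull (c ^ 2) c 0 x₀ u) τ (R y)) with hZ
    have hZμ : ∀ τ < 0, ∀ y, Z τ y = μ • u τ y := by
      intro τ hτ y
      simp only [hZ, Pi.smul_apply, stPull_apply, zero_add, LinearIsometryEquiv.map_smul]
      exact hch τ hτ y
    have hZs : Z s = fun y => μ • u s y := funext fun y => hZμ s (hs.trans ht) y
    have hZid := zoom_mild_identity hu hc R x₀ hs ht x
    have hD : oseenDuhamel 1 s Z Z t x = (μ * μ) • oseenDuhamel 1 s u u t x := by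
      rw [← oseenDuhamel_const_smul]
      refine oseenDuhamel_congr_Ioo (fun τ hτ => ?_) (fun τ hτ => ?_) x <;>
      · funext y; rw [hZμ τ (hτ.2.trans ht)]; rfl
    change Z t x = UnboundedOperators.heatExtension (Z s) (t - s) x - oseenDuhamel 1 s Z Z t x at hZid
    rw [hZμ t ht x, hZs, UnboundedOperators.heatExtension_const_smul, hD] at hZid
    exact duhamel_eq_zero_of_character hμ0 hμ1 (hu.mild_eq_heatExtension hs ht x) hZid

/-! ## D. Cells of the meter (all DECIDED by specialising the head) -/

/-- **Row S1ev (EVEN fields)** — census S-block cell: a Type-I ancient mild field with `u(t, -x) = u(t, x)`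
vanishes (character `-1` of the point reflection `x ↦ -x`: `g = (1, -I, 0)`, `g·u = -u(t,-·)`).  The ODD
fields `u(t,-x) = -u(t,x)` (character `+1`, reflection-EQUIVARIANT) are NOT claimed. -/
def Row_S1ev : Prop :=
  ∀ (C : ℝ) (u : ℝ → E3 → E3), IsTypeIAncientMild C u →
    (∀ t : ℝ, t < 0 → ∀ x, u t (-x) = u t x) → ∀ t < 0, ∀ x, u t x = 0

/-- S1ev from the head: character `-1` of the point reflection. -/
theorem row_S1ev_of_row_G1ch (h : Row_G1ch) : Row_S1ev := by
  intro C u hu hev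
  refine h C u hu 1 (-1) (LinearIsometryEquiv.neg ℝ) 0 one_pos (by norm_num) fun t ht x => ?_
  simp only [one_pow, one_mul, one_smul, zero_add, LinearIsometryEquiv.symm_neg,
    LinearIsometryEquiv.coe_neg, hev t ht x, neg_one_smul]

/-- **Row S1is (isometry character)** — census S-block cell: if `u(t, Rx) = μ R u(t, x)` for a linear isometry
`R` of `ℝ³` and a real `μ ≠ 1`, then `u ≡ 0` (`μ = -1`, `R` a rotation by `π`: fields ANTI-equivariant under a
half-turn; `R` a mirror: fields with the wrong mirror parity).  Equivariant fields (`μ = 1`: axisymmetric,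
helical, mirror-symmetric, …) are NOT claimed. -/
def Row_S1is : Prop :=
  ∀ (C : ℝ) (u : ℝ → E3 → E3), IsTypeIAncientMild C u →
    ∀ (R : E3 ≃ₗᵢ[ℝ] E3) (μ : ℝ), μ ≠ 1 → (∀ t : ℝ, t < 0 → ∀ x, u t (R x) = μ • R (u t x)) →
      ∀ t < 0, ∀ x, u t x = 0

/-- S1is from the head: `g = (1, R, 0)`. -/
theorem row_S1is_of_row_G1ch (h : Row_G1ch) : Row_S1is := by
  intro C u hu R μ hμ hR
  refine h C u hu 1 μ R 0 one_pos hμ fun t ht x => ?_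
  rw [one_pow, one_mul, one_smul, zero_add, one_smul, hR t ht x, LinearIsometryEquiv.map_smul,
    LinearIsometryEquiv.symm_apply_apply]

/-- **Row D1tw (twisted self-similarity)** — census D-block cell: if `c u(c²t, cx) = μ u(t, x)` on `t < 0` for
some `c > 0` and a real `μ ≠ 1` (ANTI-DSS `μ = -1`; DSS with the WRONG amplitude exponent,
`u(t,x) = (-t)^{-α}U(x/√-t)`-type scaling with `α ≠ 1/2`, `μ = c^{1-2α}`), then `u ≡ 0`.  The genuinely
discretely self-similar fields (`μ = 1`) are the census's OPEN D-block and are NOT claimed. -/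
def Row_D1tw : Prop :=
  ∀ (C : ℝ) (u : ℝ → E3 → E3), IsTypeIAncientMild C u →
    ∀ (c μ : ℝ), 0 < c → μ ≠ 1 → (∀ t : ℝ, t < 0 → ∀ x, c • u (c ^ 2 * t) (c • x) = μ • u t x) →
      ∀ t < 0, ∀ x, u t x = 0

/-- D1tw from the head: `g = (c, I, 0)`. -/
theorem row_D1tw_of_row_G1ch (h : Row_G1ch) : Row_D1tw := by
  intro C u hu c μ hc hμ hD
  have e : ∀ v : E3, (LinearIsometryEquiv.refl ℝ E3).symm v = v := fun v => rfl
  refine h C u hu c μ (LinearIsometryEquiv.refl ℝ _) 0 hc hμ fun t ht x => ?_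
  rw [e, LinearIsometryEquiv.coe_refl, id_eq, zero_add]
  exact hD t ht x

/-- **Row T1ch (translation character)** — census S-block cell: if `u(t, h + x) = μ u(t, x)` for a vector `h`
and a real `μ ≠ 1` (spatially ANTI-PERIODIC fields, `μ = -1`; Bloch-type real multipliers), then `u ≡ 0`.
Spatially periodic fields (`μ = 1`) are NOT claimed here. -/
def Row_T1ch : Prop :=
  ∀ (C : ℝ) (u : ℝ → E3 → E3), IsTypeIAncientMild C u →
    ∀ (h : E3) (μ : ℝ), μ ≠ 1 → (∀ t : ℝ, t < 0 → ∀ x, u t (h + x) = μ • u t x) →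
      ∀ t < 0, ∀ x, u t x = 0

/-- T1ch from the head: `g = (1, I, h)`. -/
theorem row_T1ch_of_row_G1ch (h : Row_G1ch) : Row_T1ch := by
  intro C u hu h0 μ hμ hT
  have e : ∀ v : E3, (LinearIsometryEquiv.refl ℝ E3).symm v = v := fun v => rfl
  refine h C u hu 1 μ (LinearIsometryEquiv.refl ℝ _) h0 one_pos hμ fun t ht x => ?_
  rw [one_pow, one_mul, one_smul, e, LinearIsometryEquiv.coe_refl, id_eq, one_smul]
  exact hT t ht x

/-- **Row S1ev holds.** -/
theorem row_S1ev_holds : Row_S1ev := row_S1ev_of_row_G1ch row_G1ch_holds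
/-- **Row S1is holds.** -/
theorem row_S1is_holds : Row_S1is := row_S1is_of_row_G1ch row_G1ch_holds
/-- **Row D1tw holds.** -/
theorem row_D1tw_holds : Row_D1tw := row_D1tw_of_row_G1ch row_G1ch_holds
/-- **Row T1ch holds.** -/
theorem row_T1ch_holds : Row_T1ch := row_T1ch_of_row_G1ch row_G1ch_holds

/-! ## E. The time-shift character — Row A1fm of line «floquet-meter» RE-DECIDED by the mild degree mismatch
(nesting record; the statement is that line's `Row_A1fm` VERBATIM) -/

/-- **Row A1fm (one Floquet multiplier of the time-`τ` shift)** — VERBATIM the decided cell of line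
«floquet-meter» (same seat, LINE g13-1): `u(t + τ, ·) = μ · u(t, ·)` whenever `t + τ < 0` (`τ > 0`, `μ ∈ ℝ`)
forces `u ≡ 0`.  Re-decided here by the character method: the backward translate `v(t) = u(t - τ)` is in the
class (`IsTypeIAncientMild.comp_sub_right`) and `u = μ v` on `t < 0`, so the degree mismatch applies to the
pair `(u, v)` for `μ ∉ {0, 1}`; `μ = 1` (periodic) is Type-I decay along `t - nτ`; `μ = 0` is immediate. -/
def Row_A1fm : Prop :=
  ∀ (C : ℝ) (u : ℝ → E3 → E3), IsTypeIAncientMild C u →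
    ∀ (τ μ : ℝ), 0 < τ → (∀ t : ℝ, t + τ < 0 → ∀ x, u (t + τ) x = μ • u t x) →
      ∀ t < 0, ∀ x, u t x = 0

/-- Backward iteration of a period: `u(t) = u(t - nτ)`. -/
theorem periodic_iter {u : ℝ → E3 → E3} {τ : ℝ} (hτ : 0 ≤ τ)
    (h : ∀ t : ℝ, t + τ < 0 → ∀ x, u (t + τ) x = u t x) :
    ∀ (n : ℕ) (t : ℝ), t < 0 → ∀ x, u t x = u (t - n * τ) x := by
  intro n
  induction n with
  | zero => intro t _ x; simp
  | succ n ih =>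
    intro t ht x
    have h1 : t - ((n + 1 : ℕ) : ℝ) * τ + τ = t - n * τ := by push_cast; ring
    have hn : (0 : ℝ) ≤ n * τ := by positivity
    have h2 := h (t - ((n + 1 : ℕ) : ℝ) * τ) (by rw [h1]; linarith) x
    rw [h1] at h2
    rw [ih t ht x, h2]

/-- **Row A1fm re-decided** (second, independent kernel proof of line «floquet-meter»'s cell). -/
theorem row_A1fm_bis : Row_A1fm := by
  intro C u hu τ μ hτ hfl t ht x
  have hv : IsTypeIAncientMild C (fun s => u (s - τ)) := hu.comp_sub_right hτ.le
  have huv : ∀ s < 0, ∀ y, u s y = μ • u (s - τ) y := by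
    intro s hs y
    have h := hfl (s - τ) (by linarith) y
    rwa [sub_add_cancel] at h
  by_cases hμ1 : μ = 1
  · -- periodic: Type-I decay along the backward orbit `t - nτ`
    subst hμ1
    have hper : ∀ s : ℝ, s + τ < 0 → ∀ y, u (s + τ) y = u s y := by
      intro s hs y; rw [hfl s hs y, one_smul]
    have hle : ∀ n : ℕ, ‖u t x‖ ≤ C / Real.sqrt (-(t - n * τ)) := by
      intro n
      have hn : (0 : ℝ) ≤ n * τ := by positivity
      rw [periodic_iter hτ.le hper n t ht x]
      exact hu.norm_le (by linarith) x
    have h0 : Tendsto (fun n : ℕ => (n : ℝ) * τ) atTop atTop :=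
      tendsto_natCast_atTop_atTop.atTop_mul_const hτ
    have h1 : Tendsto (fun n : ℕ => t - (n : ℝ) * τ) atTop atBot := by
      simpa [sub_eq_add_neg] using
        tendsto_atBot_add_const_left atTop t (tendsto_neg_atTop_atBot.comp h0)
    have hlim : Tendsto (fun n : ℕ => C / Real.sqrt (-(t - (n : ℝ) * τ))) atTop (𝓝 0) :=
      ((show Tendsto (fun s : ℝ => C / Real.sqrt (-s)) atBot (𝓝 0) from (Real.tendsto_sqrt_atTop.comp tendsto_neg_atBot_atTop).const_div_atTop C)).comp h1
    have h3 : ‖u t x‖ ≤ 0 := ge_of_tendsto' hlim hle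
    exact norm_le_zero_iff.1 h3
  by_cases hμ0 : μ = 0
  · rw [huv t ht x, hμ0, zero_smul]
  -- `μ ∉ {0, 1}`: the degree mismatch for the pair `u = μ v`, `v = u(· - τ)` in the class
  have hv0 : ∀ t' < 0, ∀ y, u (t' - τ) y = 0 := by
    intro t' ht' y
    refine eq_zero_of_duhamel_eq_zero hv ht' y fun s hs => ?_
    have h1 : u (t' - τ) y =
        UnboundedOperators.heatExtension (u (s - τ)) (t' - s) y -
          oseenDuhamel 1 s (fun σ => u (σ - τ)) (fun σ => u (σ - τ)) t' y :=
      hv.mild_eq_heatExtension hs ht' y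
    have h2 : u t' y = UnboundedOperators.heatExtension (u s) (t' - s) y - oseenDuhamel 1 s u u t' y :=
      hu.mild_eq_heatExtension hs ht' y
    have hus : u s = fun z => μ • u (s - τ) z := funext fun z => huv s (hs.trans ht') z
    have hD : oseenDuhamel 1 s u u t' y =
        (μ * μ) • oseenDuhamel 1 s (fun σ => u (σ - τ)) (fun σ => u (σ - τ)) t' y := by
      rw [← oseenDuhamel_const_smul]
      refine oseenDuhamel_congr_Ioo (fun σ hσ => ?_) (fun σ hσ => ?_) y <;>
      · funext z; rw [huv σ (hσ.2.trans ht')]; rfl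
    rw [huv t' ht' y, hus, UnboundedOperators.heatExtension_const_smul, hD] at h2
    exact duhamel_eq_zero_of_character hμ0 hμ1 h1 h2
  rw [huv t ht x, hv0 t ht x, smul_zero]

/-! ## F. Beyond constant characters: the MODULATED multiplier (typed OPEN) -/

/-- **Row P1pm (modulated Floquet multiplier; OPEN, typed)** — census A-block row in (L′)-shape: if the slices
one period apart are PARALLEL, `u(t + τ, ·) = m(t) · u(t, ·)` for `t + τ < 0` with an ARBITRARY real
amplitude law `m : ℝ → ℝ` (a cocycle-twisted time shift: `m` constant = `Row_A1fm`, DECIDED; `m ≡ 1` periodic),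
then `u ≡ 0`.  The degree mismatch reads `m(t)(H - D) = H[m(s)u(s)] - B(m u, m u)` and no longer separates
`D`: this is the first row BEYOND the character meter (the refuting-instrument direction: amplitude modulation). -/
@[conjecture] def Row_P1pm : Prop :=
  ∀ (C : ℝ) (u : ℝ → E3 → E3), IsTypeIAncientMild C u →
    ∀ (τ : ℝ) (m : ℝ → ℝ), 0 < τ → (∀ t : ℝ, t + τ < 0 → ∀ x, u (t + τ) x = m t • u t x) →
      ∀ t < 0, ∀ x, u t x = 0

/-- The constant amplitude law is the decided cell: `Row_P1pm → Row_A1fm`. -/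
theorem row_A1fm_of_row_P1pm (h : Row_P1pm) : Row_A1fm :=
  fun C u hu τ μ hτ hfl => h C u hu τ (fun _ => μ) hτ hfl

/-- Summary: every cell of the character meter is decided in kernel. -/
theorem characterMeter_cells_decided :
    Row_G1ch ∧ Row_S1ev ∧ Row_S1is ∧ Row_D1tw ∧ Row_T1ch ∧ Row_A1fm :=
  ⟨row_G1ch_holds, row_S1ev_holds, row_S1is_holds, row_D1tw_holds, row_T1ch_holds, row_A1fm_bis⟩

end Summit.NavierStokesRegularity.NavierStokesRegularity.Theorems.ScenarioCensus.CharacterMeter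

namespace Summit.NavierStokesRegularity.NavierStokesRegularity.Theorems.ScenarioCensus

/-! ## Census KEYS (ns `…Theorems.ScenarioCensus`): instrument CHARACTER METER (block A2) — TREE-decided members G1ch / S1ev / S1is / D1tw / T1ch, OPEN row P1pm -/

/-- **Cell G1ch** (head: a Type-I ancient mild field carrying a nontrivial real character `μ ≠ 1` of the symmetry group (parabolic zoom ∘ linear isometry ∘ translation) vanishes): `:= CharacterMeter.Row_G1ch`. DECIDED. -/
def Row_G1ch : Prop := CharacterMeter.Row_G1ch
/-- G1ch is EXCLUDED (decided in the tree): `CharacterMeter.row_G1ch_holds`. -/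
theorem row_G1ch_excluded : Row_G1ch := CharacterMeter.row_G1ch_holds

/-- **Cell S1ev** (EVEN fields `u(t,−x) = u(t,x)` vanish): `:= CharacterMeter.Row_S1ev`. DECIDED. -/
def Row_S1ev : Prop := CharacterMeter.Row_S1ev
/-- S1ev is EXCLUDED (decided in the tree): `CharacterMeter.row_S1ev_holds`. -/
theorem row_S1ev_excluded : Row_S1ev := CharacterMeter.row_S1ev_holds

/-- **Cell S1is** (isometry character `u(t,Rx) = μ R u(t,x)`, `μ ≠ 1` ⇒ `u ≡ 0`): `:= CharacterMeter.Row_S1is`. DECIDED. -/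
def Row_S1is : Prop := CharacterMeter.Row_S1is
/-- S1is is EXCLUDED (decided in the tree): `CharacterMeter.row_S1is_holds`. -/
theorem row_S1is_excluded : Row_S1is := CharacterMeter.row_S1is_holds

/-- **Cell D1tw** (twisted self-similarity `c u(c²t, cx) = μ u(t,x)`, `μ ≠ 1` ⇒ `u ≡ 0`): `:= CharacterMeter.Row_D1tw`. DECIDED. -/
def Row_D1tw : Prop := CharacterMeter.Row_D1tw
/-- D1tw is EXCLUDED (decided in the tree): `CharacterMeter.row_D1tw_holds`. -/
theorem row_D1tw_excluded : Row_D1tw := CharacterMeter.row_D1tw_holds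

/-- **Cell T1ch** (translation character `u(t, h + x) = μ u(t,x)`, `μ ≠ 1` ⇒ `u ≡ 0`): `:= CharacterMeter.Row_T1ch`. DECIDED. -/
def Row_T1ch : Prop := CharacterMeter.Row_T1ch
/-- T1ch is EXCLUDED (decided in the tree): `CharacterMeter.row_T1ch_holds`. -/
theorem row_T1ch_excluded : Row_T1ch := CharacterMeter.row_T1ch_holds

/-- **Row P1pm** (modulated Floquet multiplier `u(t+τ,·) = m(t) u(t,·)`, `m` arbitrary ⇒ `u ≡ 0`) — typed only: `:= CharacterMeter.Row_P1pm`. OPEN (no witness, no proof). -/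
@[conjecture] def Row_P1pm : Prop := CharacterMeter.Row_P1pm

end Summit.NavierStokesRegularity.NavierStokesRegularity.Theorems.ScenarioCensus

end
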